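import Mathlib
import Literature.NumberTheory.Automorphic.HeckeCommonEigenvector
import Summits.CriticalPhenomena.PercolationContinuityZ3.Theorems.PercNearOneGluingNoHeavyLowerTailOrderedDifferencesTwoChain
import Summits.CriticalPhenomena.PercolationContinuityZ3.Theorems.PercNearOneGluingNoHeavyLowerTailOrderedDifferencesTwoTransitive

/-!
# Symmetric families II: abelian symmetry — a dependency may be taken to be a character (THEOREM S (iii))

Helper file for crux `stmt-CriticalPhenomena-4575` (`NoHeavyLowerTail`, route `PercNearOneGluingNoHeavy`), new-inequality factory
seat `prim-ineq-gen-3` (gen 28).  Everything here is PROVED; no definitions.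

Notation (memo `run/shared/lean/prim/prim-ineq-gen-3/THEOREM-SYMFIELD.md`): for a finite family `𝒜` with difference family
`D = 𝒜 \\ 𝒜` a DEPENDENCY of the pencil at `t` is a coefficient vector `c` with `∑_A c_A ([E ⊆ A] + t [E ∩ A = ∅]) = 0` for every
`E ∈ D`.  Let a finite ABELIAN group `G` act on the members through `ρ : G →* Perm 𝒜` by permutations that map dependencies to
dependencies (e.g. induced by ground-set symmetries of `𝒜`, `…OrderedDifferencesTwoTransitive.pencil_dependency_comp_perm`).
Over an algebraically closed field:

* `exists_eigen_dependency_of_comm` — ★ if there is a non-zero dependency at `t`, there is one which is a SIMULTANEOUS EIGENVECTOR of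
  `G`: `w ∘ ρ g = χ(g) · w` with `χ(g)^{|G|} = 1` for every `g`.  [The dependencies form a `G`-invariant finite-dimensional subspace;
  the commuting operators `d ↦ d ∘ ρ g` have a common eigenvector there
  (`Literature.….exists_common_eigenvector_of_forall_comm`); `ρ g^{|G|} = 1` gives `χ(g)^{|G|} = 1`.]
* `exists_rootOfUnity_dependency_of_comm_transitive` — ★ THEOREM S (iii): if moreover `G` is TRANSITIVE on the members
  ("Cayley families": the members form one orbit of an abelian group of symmetries), then a non-zero dependency at `t` may be replaced
  by one whose coefficients are ALL `|G|`-th roots of unity (normalised to `1` at a chosen member) — the dependency is a character.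
* `exists_eq_neg_div_of_comm_transitive` — hence `t = −a/b` where `a = ∑_{A ⊇ E} w_A` and `b = ∑_{A ∩ E = ∅} w_A ≠ 0` are sums of
  `|G|`-th roots of unity, for some column `E ∈ 𝒜 \\ 𝒜` [some avoidance sum is non-zero, else all containment sums vanish and
  `w = 0` by the Marica–Schönheim rank theorem `eq_zero_of_sum_incidence_diffs_eq_zero`]: every bad `t` of a Cayley family lies in
  the cyclotomic field `ℚ(ζ_{|G|})`.
* `exists_rootOfUnity_dependency_of_ground_comm_transitive` — the same with the symmetries given as permutations of the ground set.
This is the theorem behind the gen-27/28 character censuses (`cychar.py`, `cyc2.py`): for a member-transitive abelian symmetry group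
(C0) fails at some `t` iff some CHARACTER of `G` is a dependency, a finite exact test.  (prim-ineq-gen-3 gen 28, 2026-08-25.)
-/

namespace Summit.CriticalPhenomena.PercolationContinuityZ3.Theorems

namespace OrderedDifferences

open Finset
open scoped FinsetFamily

variable {α : Type*} [DecidableEq α] {K : Type*} [Field K]

/-- **Abelian symmetry: an eigen-dependency.**  Let `K` be algebraically closed, `G` a finite abelian group acting on the members of
`𝒜` through `ρ : G →* Perm 𝒜` by dependency-preserving permutations.  If the pencil at `t` has a non-zero dependency, it has a
non-zero dependency `w` with `w (ρ g A) = χ_g · w A` for all `g, A`, where `χ_g ^ |G| = 1`. -/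
theorem exists_eigen_dependency_of_comm [IsAlgClosed K] (𝒜 : Finset (Finset α)) (t : K)
    {G : Type*} [CommGroup G] [Fintype G] (ρ : G →* Equiv.Perm ↥𝒜)
    (hinv : ∀ g : G, ∀ d : ↥𝒜 → K,
      (∀ E ∈ 𝒜 \\ 𝒜, ∑ A : 𝒜, d A * ((if E ⊆ (A : Finset α) then (1 : K) else 0) +
        t * (if Disjoint E (A : Finset α) then (1 : K) else 0)) = 0) →
      (∀ E ∈ 𝒜 \\ 𝒜, ∑ A : 𝒜, (d ∘ ⇑(ρ g)) A * ((if E ⊆ (A : Finset α) then (1 : K) else 0) +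
        t * (if Disjoint E (A : Finset α) then (1 : K) else 0)) = 0))
    (c : ↥𝒜 → K) (hc : c ≠ 0)
    (hdep : ∀ E ∈ 𝒜 \\ 𝒜, ∑ A : 𝒜, c A * ((if E ⊆ (A : Finset α) then (1 : K) else 0) +
        t * (if Disjoint E (A : Finset α) then (1 : K) else 0)) = 0) :
    ∃ w : ↥𝒜 → K, w ≠ 0 ∧
      (∀ E ∈ 𝒜 \\ 𝒜, ∑ A : 𝒜, w A * ((if E ⊆ (A : Finset α) then (1 : K) else 0) +
        t * (if Disjoint E (A : Finset α) then (1 : K) else 0)) = 0) ∧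
      ∀ g : G, ∃ χ : K, χ ^ Fintype.card G = 1 ∧ ∀ A : ↥𝒜, w (ρ g A) = χ * w A := by
  classical
  -- the space of dependencies at `t`
  let V : Submodule K (↥𝒜 → K) :=
    { carrier := {d | ∀ E ∈ 𝒜 \\ 𝒜, ∑ A : 𝒜, d A * ((if E ⊆ (A : Finset α) then (1 : K) else 0) +
        t * (if Disjoint E (A : Finset α) then (1 : K) else 0)) = 0}
      add_mem' := by
        intro d e hd he E hE
        have h1 := hd E hE
        have h2 := he E hE
        simp only [Pi.add_apply, add_mul, sum_add_distrib, h1, h2, add_zero]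
      zero_mem' := by
        intro E hE
        simp
      smul_mem' := by
        intro r d hd E hE
        have h1 := hd E hE
        simp only [Pi.smul_apply, smul_eq_mul, mul_assoc, ← mul_sum, h1, mul_zero] }
  have hmemV : ∀ d : ↥𝒜 → K, d ∈ V ↔ ∀ E ∈ 𝒜 \\ 𝒜, ∑ A : 𝒜, d A * ((if E ⊆ (A : Finset α) then (1 : K) else 0) +
        t * (if Disjoint E (A : Finset α) then (1 : K) else 0)) = 0 := fun d => Iff.rfl
  have hcV : c ∈ V := (hmemV c).mpr hdep
  have hVne : V ≠ ⊥ := (Submodule.ne_bot_iff V).mpr ⟨c, hcV, hc⟩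
  -- the commuting family of operators `d ↦ d ∘ ρ g`
  let L : G → ((↥𝒜 → K) →ₗ[K] (↥𝒜 → K)) := fun g => LinearMap.funLeft K K ⇑(ρ g)
  have hL : ∀ g d, L g d = d ∘ ⇑(ρ g) := fun g d => rfl
  let 𝒮 : Set ((↥𝒜 → K) →ₗ[K] (↥𝒜 → K)) := Set.range L
  have hstab : ∀ T ∈ 𝒮, ∀ m ∈ V, T m ∈ V := by
    rintro T ⟨g, rfl⟩ m hm
    rw [hL]
    exact (hmemV _).mpr (hinv g m ((hmemV m).mp hm))
  have hcomm : ∀ S ∈ 𝒮, ∀ T ∈ 𝒮, ∀ m ∈ V, S (T m) = T (S m) := by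
    rintro S ⟨g, rfl⟩ T ⟨h, rfl⟩ m -
    rw [hL, hL, hL, hL, Function.comp_assoc, Function.comp_assoc, ← Equiv.Perm.coe_mul, ← Equiv.Perm.coe_mul,
      ← map_mul, ← map_mul, mul_comm h g]
  obtain ⟨w, hwV, hw0, heig⟩ :=
    Literature.NumberTheory.Automorphic.exists_common_eigenvector_of_forall_comm V hVne 𝒮 hstab hcomm
  refine ⟨w, hw0, (hmemV w).mp hwV, fun g => ?_⟩
  obtain ⟨χ, hχ⟩ := heig (L g) ⟨g, rfl⟩
  rw [hL] at hχ
  have hχA : ∀ A : ↥𝒜, w (ρ g A) = χ * w A := by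
    intro A
    have h := congr_fun hχ A
    simpa only [Function.comp_apply, Pi.smul_apply, smul_eq_mul] using h
  refine ⟨χ, ?_, hχA⟩
  -- iterate: `w (ρ (g ^ n) A) = χ ^ n * w A`
  have hiter : ∀ n : ℕ, ∀ A : ↥𝒜, w (ρ (g ^ n) A) = χ ^ n * w A := by
    intro n
    induction n with
    | zero => intro A; simp
    | succ n ih =>
        intro A
        rw [pow_succ, map_mul, Equiv.Perm.mul_apply, ih (ρ g A), hχA A, pow_succ]
        ring
  obtain ⟨A1, hA1⟩ : ∃ A1, w A1 ≠ 0 := Function.ne_iff.mp hw0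
  have h := hiter (Fintype.card G) A1
  rw [pow_card_eq_one, map_one, Equiv.Perm.one_apply] at h
  -- `w A1 = χ ^ |G| * w A1` with `w A1 ≠ 0`
  have h' : (χ ^ Fintype.card G - 1) * w A1 = 0 := by linear_combination -h
  exact sub_eq_zero.mp ((mul_eq_zero.mp h').resolve_right hA1)

/-- **THEOREM S (iii): Cayley families have character dependencies.**  Let `K` be algebraically closed and let a finite abelian group
`G` act on the members of `𝒜` through `ρ : G →* Perm 𝒜`, TRANSITIVELY and by dependency-preserving permutations.  If the pencil at
`t` has a non-zero dependency then, for any member `A₀`, it has a dependency `w` with `w A₀ = 1` all of whose coefficients are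
`|G|`-th roots of unity. -/
theorem exists_rootOfUnity_dependency_of_comm_transitive [IsAlgClosed K] (𝒜 : Finset (Finset α)) (t : K)
    {G : Type*} [CommGroup G] [Fintype G] (ρ : G →* Equiv.Perm ↥𝒜)
    (hinv : ∀ g : G, ∀ d : ↥𝒜 → K,
      (∀ E ∈ 𝒜 \\ 𝒜, ∑ A : 𝒜, d A * ((if E ⊆ (A : Finset α) then (1 : K) else 0) +
        t * (if Disjoint E (A : Finset α) then (1 : K) else 0)) = 0) →
      (∀ E ∈ 𝒜 \\ 𝒜, ∑ A : 𝒜, (d ∘ ⇑(ρ g)) A * ((if E ⊆ (A : Finset α) then (1 : K) else 0) +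
        t * (if Disjoint E (A : Finset α) then (1 : K) else 0)) = 0))
    (htrans : ∀ A B : ↥𝒜, ∃ g : G, ρ g A = B)
    (c : ↥𝒜 → K) (hc : c ≠ 0)
    (hdep : ∀ E ∈ 𝒜 \\ 𝒜, ∑ A : 𝒜, c A * ((if E ⊆ (A : Finset α) then (1 : K) else 0) +
        t * (if Disjoint E (A : Finset α) then (1 : K) else 0)) = 0)
    (A0 : ↥𝒜) :
    ∃ w : ↥𝒜 → K,
      (∀ E ∈ 𝒜 \\ 𝒜, ∑ A : 𝒜, w A * ((if E ⊆ (A : Finset α) then (1 : K) else 0) +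
        t * (if Disjoint E (A : Finset α) then (1 : K) else 0)) = 0) ∧
      w A0 = 1 ∧ ∀ A : ↥𝒜, (w A) ^ Fintype.card G = 1 := by
  classical
  obtain ⟨w, hw0, hwdep, heig⟩ := exists_eigen_dependency_of_comm 𝒜 t ρ hinv c hc hdep
  obtain ⟨A1, hA1⟩ : ∃ A1, w A1 ≠ 0 := Function.ne_iff.mp hw0
  -- every coefficient is a root of unity times `w A1`, in particular non-zero
  have hroot : ∀ A : ↥𝒜, ∃ χ : K, χ ^ Fintype.card G = 1 ∧ w A = χ * w A1 := by
    intro A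
    obtain ⟨g, hg⟩ := htrans A1 A
    obtain ⟨χ, hχ1, hχ⟩ := heig g
    exact ⟨χ, hχ1, by rw [← hg, hχ A1]⟩
  have hcardpos : 0 < Fintype.card G := Fintype.card_pos_iff.mpr ⟨1⟩
  have hne : ∀ A : ↥𝒜, w A ≠ 0 := by
    intro A
    obtain ⟨χ, hχ1, hχ⟩ := hroot A
    have hχ0 : χ ≠ 0 := by
      intro h0
      rw [h0, zero_pow hcardpos.ne'] at hχ1
      exact zero_ne_one hχ1
    rw [hχ]
    exact mul_ne_zero hχ0 hA1
  -- normalise at `A0`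
  refine ⟨fun A => (w A0)⁻¹ * w A, ?_, ?_, ?_⟩
  · intro E hE
    have h := hwdep E hE
    have e : ∑ A : 𝒜, (w A0)⁻¹ * w A * ((if E ⊆ (A : Finset α) then (1 : K) else 0) +
        t * (if Disjoint E (A : Finset α) then (1 : K) else 0)) =
        (w A0)⁻¹ * ∑ A : 𝒜, w A * ((if E ⊆ (A : Finset α) then (1 : K) else 0) +
        t * (if Disjoint E (A : Finset α) then (1 : K) else 0)) := by
      rw [mul_sum]
      refine sum_congr rfl fun A _ => ?_
      ring
    rw [e, h, mul_zero]
  · exact inv_mul_cancel₀ (hne A0)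
  · intro A
    obtain ⟨χ, hχ1, hχ⟩ := hroot A
    obtain ⟨χ0, hχ01, hχ0⟩ := hroot A0
    have hχ0ne : χ0 ≠ 0 := by
      intro h0
      rw [h0, zero_pow hcardpos.ne'] at hχ01
      exact zero_ne_one hχ01
    have e : (w A0)⁻¹ * w A = χ * χ0⁻¹ := by
      rw [hχ, hχ0]
      field_simp
    show ((w A0)⁻¹ * w A) ^ Fintype.card G = 1
    rw [e, mul_pow, inv_pow, hχ1, hχ01, inv_one, mul_one]

/-- **Every bad `t` of a Cayley family is a ratio of sums of roots of unity.**  Under the hypotheses of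
`exists_rootOfUnity_dependency_of_comm_transitive`, there are a dependency `w` with all coefficients `|G|`-th roots of unity and a
column `E ∈ 𝒜 \\ 𝒜` whose avoidance sum `b = ∑_{A ∩ E = ∅} w_A` is non-zero, and then `t = −a/b` with `a = ∑_{A ⊇ E} w_A`. -/
theorem exists_eq_neg_div_of_comm_transitive [IsAlgClosed K] (𝒜 : Finset (Finset α)) (t : K)
    {G : Type*} [CommGroup G] [Fintype G] (ρ : G →* Equiv.Perm ↥𝒜)
    (hinv : ∀ g : G, ∀ d : ↥𝒜 → K,
      (∀ E ∈ 𝒜 \\ 𝒜, ∑ A : 𝒜, d A * ((if E ⊆ (A : Finset α) then (1 : K) else 0) +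
        t * (if Disjoint E (A : Finset α) then (1 : K) else 0)) = 0) →
      (∀ E ∈ 𝒜 \\ 𝒜, ∑ A : 𝒜, (d ∘ ⇑(ρ g)) A * ((if E ⊆ (A : Finset α) then (1 : K) else 0) +
        t * (if Disjoint E (A : Finset α) then (1 : K) else 0)) = 0))
    (htrans : ∀ A B : ↥𝒜, ∃ g : G, ρ g A = B)
    (c : ↥𝒜 → K) (hc : c ≠ 0)
    (hdep : ∀ E ∈ 𝒜 \\ 𝒜, ∑ A : 𝒜, c A * ((if E ⊆ (A : Finset α) then (1 : K) else 0) +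
        t * (if Disjoint E (A : Finset α) then (1 : K) else 0)) = 0) :
    ∃ w : ↥𝒜 → K, (∀ A : ↥𝒜, (w A) ^ Fintype.card G = 1) ∧
      ∃ E ∈ 𝒜 \\ 𝒜, (∑ A : 𝒜, w A * (if Disjoint E (A : Finset α) then (1 : K) else 0)) ≠ 0 ∧
        t = -(∑ A : 𝒜, w A * (if E ⊆ (A : Finset α) then (1 : K) else 0)) /
          (∑ A : 𝒜, w A * (if Disjoint E (A : Finset α) then (1 : K) else 0)) := by
  classical
  obtain ⟨A0, hA0⟩ : ∃ A0, c A0 ≠ 0 := Function.ne_iff.mp hc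
  obtain ⟨w, hwdep, hw1, hwroot⟩ :=
    exists_rootOfUnity_dependency_of_comm_transitive 𝒜 t ρ hinv htrans c hc hdep A0
  refine ⟨w, hwroot, ?_⟩
  -- some avoidance sum is non-zero, else all containment sums vanish and `w = 0`
  have hw0 : w ≠ 0 := by
    intro h
    have := congr_fun h A0
    rw [hw1, Pi.zero_apply] at this
    exact one_ne_zero this
  by_contra hno
  push Not at hno
  have hall : ∀ E ∈ 𝒜 \\ 𝒜, ∑ A : 𝒜, w A * (if Disjoint E (A : Finset α) then (1 : K) else 0) = 0 := by
    intro E hE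
    by_contra hb
    have h := hwdep E hE
    refine hno E hE hb ?_
    have e : ∑ A : 𝒜, w A * ((if E ⊆ (A : Finset α) then (1 : K) else 0) +
        t * (if Disjoint E (A : Finset α) then (1 : K) else 0)) =
        (∑ A : 𝒜, w A * (if E ⊆ (A : Finset α) then (1 : K) else 0)) +
        t * ∑ A : 𝒜, w A * (if Disjoint E (A : Finset α) then (1 : K) else 0) := by
      rw [mul_sum, ← sum_add_distrib]
      refine sum_congr rfl fun A _ => ?_
      ring
    rw [e] at h
    field_simp
    linear_combination h
  have hcont : ∀ E ∈ 𝒜 \\ 𝒜, ∑ A : 𝒜, w A * (if E ⊆ (A : Finset α) then (1 : K) else 0) = 0 := by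
    intro E hE
    have h := hwdep E hE
    have e : ∑ A : 𝒜, w A * ((if E ⊆ (A : Finset α) then (1 : K) else 0) +
        t * (if Disjoint E (A : Finset α) then (1 : K) else 0)) =
        (∑ A : 𝒜, w A * (if E ⊆ (A : Finset α) then (1 : K) else 0)) +
        t * ∑ A : 𝒜, w A * (if Disjoint E (A : Finset α) then (1 : K) else 0) := by
      rw [mul_sum, ← sum_add_distrib]
      refine sum_congr rfl fun A _ => ?_
      ring
    rw [e, hall E hE, mul_zero, add_zero] at h
    exact h
  exact hw0 (eq_zero_of_sum_incidence_diffs_eq_zero (K := K) 𝒜 w hcont)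

/-- **THEOREM S (iii) for ground-set symmetries.**  Let `K` be algebraically closed and let a finite abelian group `G` act on the
members of `𝒜` through `ρ : G →* Perm 𝒜`, each `ρ g` induced by a permutation of the ground set (`x ∈ ρ g A ↔ σ⁻¹ x ∈ A`), transitively
on the members.  If the pencil at `t` has a non-zero dependency then it has one with `w A₀ = 1` and all coefficients `|G|`-th roots
of unity. -/
theorem exists_rootOfUnity_dependency_of_ground_comm_transitive [IsAlgClosed K] (𝒜 : Finset (Finset α)) (t : K)
    {G : Type*} [CommGroup G] [Fintype G] (ρ : G →* Equiv.Perm ↥𝒜)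
    (hρ : ∀ g : G, ∃ σ : Equiv.Perm α, ∀ A : ↥𝒜, ∀ x, x ∈ ((ρ g A : ↥𝒜) : Finset α) ↔ σ.symm x ∈ (A : Finset α))
    (htrans : ∀ A B : ↥𝒜, ∃ g : G, ρ g A = B)
    (c : ↥𝒜 → K) (hc : c ≠ 0)
    (hdep : ∀ E ∈ 𝒜 \\ 𝒜, ∑ A : 𝒜, c A * ((if E ⊆ (A : Finset α) then (1 : K) else 0) +
        t * (if Disjoint E (A : Finset α) then (1 : K) else 0)) = 0)
    (A0 : ↥𝒜) :
    ∃ w : ↥𝒜 → K,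
      (∀ E ∈ 𝒜 \\ 𝒜, ∑ A : 𝒜, w A * ((if E ⊆ (A : Finset α) then (1 : K) else 0) +
        t * (if Disjoint E (A : Finset α) then (1 : K) else 0)) = 0) ∧
      w A0 = 1 ∧ ∀ A : ↥𝒜, (w A) ^ Fintype.card G = 1 := by
  refine exists_rootOfUnity_dependency_of_comm_transitive 𝒜 t ρ (fun g d hd => ?_) htrans c hc hdep A0
  obtain ⟨σ, hσ⟩ := hρ g
  exact pencil_dependency_comp_perm 𝒜 t (ρ g) σ hσ d hd

end OrderedDifferences

end Summit.CriticalPhenomena.PercolationContinuityZ3.Theorems
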